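import Literature.MathematicalPhysics.QuantumFieldTheory.Balaban1983to89.B14Eq328Printed

/-!
# `Balaban1983to89.B14.Eq328SharpCutoff` — T. Bałaban, *Convergent renormalization expansions for lattice gauge theories*,
# Commun. Math. Phys. **119** (1988) 243–285 [Balaban1988Convergent] = [III]: (3.28) FIRST PRINTED EQUALITY and (3.29)
# pp. 271–272 WITH PRINT'S SHARP CUT-OFF — `χ^{(k)}` the CHARACTERISTIC FUNCTION of a set of fluctuation fields — for
# genuine finite-dimensional Gaussian integrals (file 3 of the (3.28) files; files 1–2 = `B14.Eq329Family`,
# `B14.Eq328Printed`, which carry a `C¹` cut-off)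

statement-level skeleton of published theorems with citation tags; proofs where landed; nothing here is a claim
about the Yang–Mills mass gap

CITATION HEADER (lean-in-tree rule).  T. Bałaban, *Convergent renormalization expansions for lattice gauge theories*,
Commun. Math. Phys. **119**, 243–285 (1988), doi:10.1007/BF01217741, bib `Balaban1988Convergent` (cell paper B14 = "[III]";
PDF held `paper:balaban1988-cmp119-convergent-renormalization`, journal page = PDF page + 242; (3.28)–(3.29) read on the x2
renders `…-p029-x2.png` / `…-p030-x2.png` of `run/shared/lean/pub/pub-balaban/b2b-balaban-ref1/pages/
1988-cmp119-convergent-renormalization/`).  Mega-formalization `lit-balaban` (HOME `run/shared/lean/pub/lit-balaban/`), Phase-2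
proof seat **p27 gen 91** (free target, protocol G.5-34 (d), TAKING #2 HOME/STATUS 2026-08-26T03:0xZ; B14 fold owner r11);
SKELETON row **B14.Eq3.28–3.29** (cells only; decls of record untouched).

WHY THIS FILE.  In print `χ^{(k)}` IS a characteristic function (p. 268: the characteristic functions `χ^{(k)}`,
`χ(Ω_{k+1} ∩ Λ^c_{k+1}, S_{k+1})` of the small-field conditions; (3.29) *"Z_t^{−1} dμ_{C^{(k)}(Λ_{k+1})}(A) χ^{(k)} exp[…]"*).
Files 1–2 typed BOTH equalities of (3.28) for a `C¹` cut-off `χ ≥ 0` (their HONEST-SCOPE caveat (1)), because the SECOND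
equality differentiates `χ` (*"(δ/δA)χ^{(k)}"*, a boundary term for a sharp cut-off).  The FIRST equality — the fundamental
theorem of calculus in *"the parameter t multiplying A_k"* — and the probabilistic measure (3.29) never differentiate `χ`:
they hold VERBATIM for the sharp cut-off.  This file proves them in that form, removing caveat (1) where it is removable.

THE PRINT (pp. 271–272, verbatim, the members typed here).  *"We introduce the parameter t multiplying A_k in the
expressions in the logarithm. We have
  log[z^{(k)} ∫ dA χ^{(k)} exp[−½⟨A, C*Δ^{(k)}CA⟩ − ….(s = 0, t = 0)….]]
  = ∫₀¹ dt ⟨ −⟨A, C*Δ^{(k)}CA_k⟩ + ⟨(δ/δtA_k) 𝐏^{(k)}(g_k, (tA_k, A)), A_k⟩ + ⟨(δ/δtA_k) 𝐄_k(U_k(….)), A_k⟩ ⟩_t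
    − ½⟨A_k, C*Δ^{(k)}CC^{(k)}(Λ_{k+1})C*Δ^{(k)}CA_k⟩ + log[z^{(k)} ∫ dA χ^{(k)} exp[−½⟨A, C*Δ^{(k)}CA⟩ − ….(s = 0, t = 0, A_k = 0)….]]
  = …  (3.28)
  Here ⟨·⟩_t denotes the expectation value with respect to the probabilistic measure
  Z_t^{−1} dμ_{C^{(k)}(Λ_{k+1})}(A) χ^{(k)} exp[−t⟨A, C*Δ^{(k)}CA_k⟩ + 𝐏^{(k)}(g_k, (tA_k, A)) + {𝐄_k(U_k(…(tA_k, A)…)) − 𝐄_k(U_{k+1})}].  (3.29)"*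

READING (as in files 1–2 and r11's `B14.Eq328GaussianIBP`): `A = v ∈ ι → ℝ`, `dμ_C(v) ∝ e^{−½vᵀC⁻¹v}dv`, `C := C^{(k)}(Λ_{k+1})`
(any matrix here — positivity of `C` is not needed for the first equality), `A_k = a ∈ κ → ℝ`, `w₀ := C*Δ^{(k)}CA_k` (so
`⟨A, C*Δ^{(k)}CA_k⟩ = ⟨v,w₀⟩`), `𝐏(a′,v)`, `𝐄(a′,v)` jointly `C¹`, `𝐄₁ := 𝐄_k(U_{k+1})`, `a′ = t•a`; NEW HERE: the cut-off is
`χ^{(k)} := 𝟙_K`, the characteristic function of a BOUNDED MEASURABLE set `K ⊂ ι → ℝ` of positive Lebesgue measure (print's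
small-field domains are bounded boxes cut out by strict inequalities — bounded, open, non-empty); reference weight `w = 𝟙_K·e^{−½vᵀC⁻¹v}`, exponent `S_t(v) = −t⟨v,w₀⟩ +
𝐏(t•a,v) + {𝐄(t•a,v) − 𝐄₁}`, `Z_t = partFn volume w S t`, `⟨G⟩_t = gibbsExpect volume w S G t`, (3.29) = `gibbsLaw volume w S t`.

WHAT THIS FILE PROVES (kernel-checked, zero `sorry`; THEOREMS ONLY — no `def`, no new `Prop`, no named fact; axioms standard):
* §1 the sharp (3.29) family: `gibbsWeight_sharp_eq` (`w e^{S_t} = 𝟙_K·(e^{−½vᵀC⁻¹v}e^{S_t})`), measurability, integrability of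
  continuous inserts (`integrable_insert_mul_gibbsWeight_sharp`), `partFn_pos_sharp` (`Z_t > 0` from `vol K > 0`), and
  **`domFamily_sharp`** — a `B14.InterpolationMeasure.DomFamily` on `(−1,2)` (domination by `𝟙_K × sup_{[−1,2]×K̄}`, `K̄` compact; the
  `t`-derivative is file 1's `hasDerivAt_gibbsWeight`, valid for ANY reference weight); hence **`eq328_ftc_sharp`**
  `log Z_1 = log Z_0 + ∫₀¹ dt ⟨∂_tS_t⟩_t` and the interval integrability of `t ↦ ⟨∂_tS_t⟩_t`;
* §2 **`eq328_first_sharp`** — THE FIRST PRINTED EQUALITY OF (3.28) WITH THE SHARP CUT-OFF: `log ∫ 𝟙_K exp[−⟨v,w₀⟩ − ½⟨w₀,Cw₀⟩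
  + 𝐏(a,v) + {𝐄(a,v) − 𝐄₁}] dμ_C = ∫₀¹ dt ⟨−⟨v,w₀⟩ + D₁𝐏(t•a,v)·a + D₁𝐄(t•a,v)·a⟩_t − ½⟨w₀,Cw₀⟩ + log ∫ 𝟙_K exp[𝐏(0,v) +
  {𝐄(0,v) − 𝐄₁}] dμ_C` (`eq328_lhs_sharp`, file 2's `partFn_zero_eq`); `eq328_first_sharp_set` — the same with `∫_K`;
* §3 **(3.29) verbatim**: `isProbabilityMeasure_gibbsLaw_sharp` (the law `Z_t⁻¹ 𝟙_K e^{S_t} dμ_C` is a probability measure for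
  every `t`) and `integral_gibbsLaw_sharp` (`⟨G⟩_t` is its expectation).
HONEST SCOPE.  The SECOND equality of (3.28) is NOT restated here: for the sharp cut-off print's *"(δ/δA)χ^{(k)}"* is a boundary
(surface) term, and the tree's typed form is the `C¹` reading of file 2 / r11's `B14.Eq328GaussianIBP` (scope note (i) there).
`𝐏`, `𝐄` are `C¹` on the whole product space (print: analytic near the `χ`-domain).  The identification with Bałaban's operators
is the READING.  NOT summit progress.  p27 gen 91 (literature-prover-lit-balaban-p27-g91-0), 2026-08-26.
-/

noncomputable section

open MeasureTheory Matrix Real Filter Topology Set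
open scoped Matrix BigOperators

namespace Literature.MathematicalPhysics.QuantumFieldTheory.Balaban1983to89.B14.Eq328SharpCutoff

open B14.InterpolationMeasure B14.Eq329Family B14.Eq328Printed

variable {ι κ : Type*} [Fintype ι] [Fintype κ]

section Family

variable [DecidableEq ι]
variable (C : Matrix ι ι ℝ) (w₀ : ι → ℝ) (a : κ → ℝ) (K : Set (ι → ℝ)) {P E : (κ → ℝ) → (ι → ℝ) → ℝ} (E₁ : ℝ)

/-! ## §1  The (3.29) family with the sharp cut-off `χ^{(k)} = 𝟙_K` is a dominated differentiable family -/

omit [Fintype κ] in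
/-- The sharp weight: `w e^{S_t} = 𝟙_K·(e^{−½vᵀC⁻¹v}·e^{S_t})` — the characteristic function is a FACTOR, as printed in
(3.29). [cite: Balaban1988Convergent, (3.29) p.272] -/
theorem gibbsWeight_sharp_eq {w : (ι → ℝ) → ℝ} (S : ℝ → (ι → ℝ) → ℝ)
    (hw : w = fun v => K.indicator (fun _ => (1:ℝ)) v * Real.exp (-(1/2 : ℝ) * (v ⬝ᵥ C⁻¹ *ᵥ v))) (t : ℝ) (v : ι → ℝ) :
    gibbsWeight w S t v = K.indicator (fun v => Real.exp (-(1/2 : ℝ) * (v ⬝ᵥ C⁻¹ *ᵥ v)) * Real.exp (S t v)) v := by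
  simp only [gibbsWeight, hw]
  by_cases hv : v ∈ K <;> simp [hv]

/-- Joint continuity of the smooth part `(t,v) ↦ e^{−½vᵀC⁻¹v}·exp[−t⟨v,w₀⟩ + 𝐏(t•a,v) + {𝐄(t•a,v) − 𝐄₁}]` of the (3.29) weight.
[cite: Balaban1988Convergent, (3.29) p.272] -/
theorem continuous_smooth₂ (hP : ContDiff ℝ 1 (Function.uncurry P)) (hE : ContDiff ℝ 1 (Function.uncurry E))
    {S : ℝ → (ι → ℝ) → ℝ} (hS : S = fun t v => -(t * (v ⬝ᵥ w₀)) + (P (t • a) v + (E (t • a) v - E₁))) :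
    Continuous fun p : ℝ × (ι → ℝ) => Real.exp (-(1/2 : ℝ) * (p.2 ⬝ᵥ C⁻¹ *ᵥ p.2)) * Real.exp (S p.1 p.2) := by
  have h2 : Continuous fun p : ℝ × (ι → ℝ) => Real.exp (-(1/2 : ℝ) * (p.2 ⬝ᵥ C⁻¹ *ᵥ p.2)) :=
    (continuous_const.mul (continuous_snd.dotProduct (continuous_const.matrix_mulVec continuous_snd))).rexp
  have h3 : Continuous fun p : ℝ × (ι → ℝ) => S p.1 p.2 := by
    rw [hS]
    exact ((continuous_fst.mul (continuous_snd.dotProduct continuous_const)).neg).add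
      ((continuous_eval hP a).add ((continuous_eval hE a).sub continuous_const))
  exact h2.mul h3.rexp

/-- Continuity of the smooth part in `v` at fixed `t`. [cite: Balaban1988Convergent, (3.29) p.272] -/
theorem continuous_smooth (hP : ContDiff ℝ 1 (Function.uncurry P)) (hE : ContDiff ℝ 1 (Function.uncurry E))
    {S : ℝ → (ι → ℝ) → ℝ} (hS : S = fun t v => -(t * (v ⬝ᵥ w₀)) + (P (t • a) v + (E (t • a) v - E₁))) (t : ℝ) :
    Continuous fun v : ι → ℝ => Real.exp (-(1/2 : ℝ) * (v ⬝ᵥ C⁻¹ *ᵥ v)) * Real.exp (S t v) :=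
  (continuous_smooth₂ C w₀ a E₁ hP hE hS).comp (continuous_const.prodMk continuous_id)

/-- A continuous insert against the sharp weight is integrable: `G·w e^{S_t} = 𝟙_K·(G·smooth part)`, continuous on the compact
closure `K̄`. [cite: Balaban1988Convergent, (3.29) p.272] -/
theorem integrable_insert_mul_gibbsWeight_sharp (hKb : Bornology.IsBounded K) (hKm : MeasurableSet K) (hP : ContDiff ℝ 1 (Function.uncurry P))
    (hE : ContDiff ℝ 1 (Function.uncurry E)) {w : (ι → ℝ) → ℝ} {S : ℝ → (ι → ℝ) → ℝ}
    (hw : w = fun v => K.indicator (fun _ => (1:ℝ)) v * Real.exp (-(1/2 : ℝ) * (v ⬝ᵥ C⁻¹ *ᵥ v)))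
    (hS : S = fun t v => -(t * (v ⬝ᵥ w₀)) + (P (t • a) v + (E (t • a) v - E₁))) (t : ℝ)
    {G : (ι → ℝ) → ℝ} (hG : Continuous G) :
    Integrable (fun v => G v * gibbsWeight w S t v) := by
  have hc : Continuous fun v : ι → ℝ => G v * (Real.exp (-(1/2 : ℝ) * (v ⬝ᵥ C⁻¹ *ᵥ v)) * Real.exp (S t v)) :=
    hG.mul (continuous_smooth C w₀ a E₁ hP hE hS t)
  refine (((hc.continuousOn.integrableOn_compact hKb.isCompact_closure).mono_set subset_closure).integrable_indicator
    hKm).congr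
    (ae_of_all _ fun v => ?_)
  dsimp only
  rw [gibbsWeight_sharp_eq C K S hw t v]
  by_cases hv : v ∈ K <;> simp [hv]

/-- The sharp weight itself is integrable. [cite: Balaban1988Convergent, (3.29) p.272] -/
theorem integrable_gibbsWeight_sharp (hKb : Bornology.IsBounded K) (hKm : MeasurableSet K) (hP : ContDiff ℝ 1 (Function.uncurry P))
    (hE : ContDiff ℝ 1 (Function.uncurry E)) {w : (ι → ℝ) → ℝ} {S : ℝ → (ι → ℝ) → ℝ}
    (hw : w = fun v => K.indicator (fun _ => (1:ℝ)) v * Real.exp (-(1/2 : ℝ) * (v ⬝ᵥ C⁻¹ *ᵥ v)))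
    (hS : S = fun t v => -(t * (v ⬝ᵥ w₀)) + (P (t • a) v + (E (t • a) v - E₁))) (t : ℝ) :
    Integrable (gibbsWeight w S t) := by
  simpa using integrable_insert_mul_gibbsWeight_sharp C w₀ a K E₁ hKb hKm hP hE hw hS t continuous_const (G := fun _ => 1)

omit [Fintype κ] in
/-- The sharp weight is non-negative. [cite: Balaban1988Convergent, (3.29) p.272] -/
theorem gibbsWeight_sharp_nonneg {w : (ι → ℝ) → ℝ} (S : ℝ → (ι → ℝ) → ℝ)
    (hw : w = fun v => K.indicator (fun _ => (1:ℝ)) v * Real.exp (-(1/2 : ℝ) * (v ⬝ᵥ C⁻¹ *ᵥ v))) (t : ℝ) (v : ι → ℝ) :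
    0 ≤ gibbsWeight w S t v := by
  rw [gibbsWeight_sharp_eq C K S hw t v]
  by_cases hv : v ∈ K
  · simp only [indicator_of_mem hv]; positivity
  · simp [hv]

/-- **`Z_t > 0` for every `t`** with the sharp cut-off: `Z_t = ∫_K e^{−½vᵀC⁻¹v}e^{S_t} dv > 0` because the integrand is positive
and `vol K > 0`. [cite: Balaban1988Convergent, (3.29) p.272] -/
theorem partFn_pos_sharp (hKb : Bornology.IsBounded K) (hKm : MeasurableSet K) (hKpos : 0 < volume K) (hP : ContDiff ℝ 1 (Function.uncurry P))
    (hE : ContDiff ℝ 1 (Function.uncurry E)) {w : (ι → ℝ) → ℝ} {S : ℝ → (ι → ℝ) → ℝ}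
    (hw : w = fun v => K.indicator (fun _ => (1:ℝ)) v * Real.exp (-(1/2 : ℝ) * (v ⬝ᵥ C⁻¹ *ᵥ v)))
    (hS : S = fun t v => -(t * (v ⬝ᵥ w₀)) + (P (t • a) v + (E (t • a) v - E₁))) (t : ℝ) :
    0 < partFn volume w S t := by
  have hg := continuous_smooth C w₀ a E₁ hP hE hS t
  have hpos : ∀ v : ι → ℝ, 0 < Real.exp (-(1/2 : ℝ) * (v ⬝ᵥ C⁻¹ *ᵥ v)) * Real.exp (S t v) := fun v => by positivity
  have heq : partFn volume w S t
      = ∫ v in K, Real.exp (-(1/2 : ℝ) * (v ⬝ᵥ C⁻¹ *ᵥ v)) * Real.exp (S t v) := by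
    unfold partFn
    rw [← integral_indicator hKm]
    exact integral_congr_ae (ae_of_all _ fun v => gibbsWeight_sharp_eq C K S hw t v)
  rw [heq, setIntegral_pos_iff_support_of_nonneg_ae (ae_of_all _ fun v => (hpos v).le)
    ((hg.continuousOn.integrableOn_compact hKb.isCompact_closure).mono_set subset_closure)]
  have hsupp : (Function.support fun v : ι → ℝ => Real.exp (-(1/2 : ℝ) * (v ⬝ᵥ C⁻¹ *ᵥ v)) * Real.exp (S t v)) ∩ K = K := by
    ext v
    simp only [Function.mem_support, mem_inter_iff, and_iff_right_iff_imp]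
    exact fun _ => (hpos v).ne'
  rwa [hsupp]

/-- **THE SHARP (3.29) FAMILY IS A DOMINATED DIFFERENTIABLE FAMILY** on `(−1,2) ⊃ [0,1]`: the `t`-derivative
`∂_t(w e^{S_t}) = (∂_tS_t)·w e^{S_t}` is file 1's `hasDerivAt_gibbsWeight` (valid for ANY reference weight `w` — the cut-off is
never differentiated), the derivative insert is dominated by `𝟙_K × sup_{[−1,2]×K̄} |∂_tS_t·smooth part|` (`K̄` the compact closure), and `Z_t > 0`.
[cite: Balaban1988Convergent, (3.28)–(3.29) pp.271–272] -/
theorem domFamily_sharp (hKb : Bornology.IsBounded K) (hKm : MeasurableSet K) (hKpos : 0 < volume K) (hP : ContDiff ℝ 1 (Function.uncurry P))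
    (hE : ContDiff ℝ 1 (Function.uncurry E)) {w : (ι → ℝ) → ℝ} {S S' : ℝ → (ι → ℝ) → ℝ}
    (hw : w = fun v => K.indicator (fun _ => (1:ℝ)) v * Real.exp (-(1/2 : ℝ) * (v ⬝ᵥ C⁻¹ *ᵥ v)))
    (hS : S = fun t v => -(t * (v ⬝ᵥ w₀)) + (P (t • a) v + (E (t • a) v - E₁)))
    (hS' : S' = fun t v => -(v ⬝ᵥ w₀) + (fderiv ℝ (fun a' => P a' v) (t • a) a + fderiv ℝ (fun a' => E a' v) (t • a) a)) :
    DomFamily volume (gibbsWeight w S) (fun t v => S' t v * gibbsWeight w S t v) (-1) 2 := by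
  have hgc := continuous_smooth₂ C w₀ a E₁ hP hE hS
  have hS'c := continuous_S'₂ w₀ a hP hE hS'
  have hS't : ∀ t, Continuous fun v => S' t v := fun t => hS'c.comp (continuous_const.prodMk continuous_id)
  obtain ⟨B, hB⟩ := (isCompact_Icc.prod hKb.isCompact_closure).exists_bound_of_continuousOn
    (s := Icc (-1 : ℝ) 2 ×ˢ closure K) (hS'c.mul hgc).continuousOn
  refine ⟨by norm_num, by norm_num, fun t _ => (integrable_gibbsWeight_sharp C w₀ a K E₁ hKb hKm hP hE hw hS t).aestronglyMeasurable,
    fun t _ => (integrable_insert_mul_gibbsWeight_sharp C w₀ a K E₁ hKb hKm hP hE hw hS t (hS't t)).aestronglyMeasurable,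
    fun t _ => integrable_gibbsWeight_sharp C w₀ a K E₁ hKb hKm hP hE hw hS t, ?_, ?_,
    fun t _ => partFn_pos_sharp C w₀ a K E₁ hKb hKm hKpos hP hE hw hS t⟩
  · exact ae_of_all _ fun v t _ => hasDerivAt_gibbsWeight w₀ a E₁ hP hE w hS hS' v t
  · refine ⟨K.indicator fun _ => B, ?_, ae_of_all _ fun v t ht => ?_⟩
    · rw [integrable_indicator_iff hKm]
      exact integrableOn_const hKb.measure_lt_top.ne
    · rw [gibbsWeight_sharp_eq C K S hw t v]
      by_cases hv : v ∈ K
      · rw [indicator_of_mem hv, indicator_of_mem hv]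
        have := hB (t, v) ⟨Ioo_subset_Icc_self ht, subset_closure hv⟩
        simpa [Real.norm_eq_abs] using this
      · simp [hv]

/-- **(3.28), THE FIRST EQUALITY IN GIBBS FORM, SHARP CUT-OFF**: `log Z_1 = log Z_0 + ∫₀¹ dt ⟨∂_tS_t⟩_t` for the (3.29) family
with `χ^{(k)} = 𝟙_K`. [cite: Balaban1988Convergent, (3.28)–(3.29) pp.271–272] -/
theorem eq328_ftc_sharp (hKb : Bornology.IsBounded K) (hKm : MeasurableSet K) (hKpos : 0 < volume K) (hP : ContDiff ℝ 1 (Function.uncurry P))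
    (hE : ContDiff ℝ 1 (Function.uncurry E)) {w : (ι → ℝ) → ℝ} {S S' : ℝ → (ι → ℝ) → ℝ}
    (hw : w = fun v => K.indicator (fun _ => (1:ℝ)) v * Real.exp (-(1/2 : ℝ) * (v ⬝ᵥ C⁻¹ *ᵥ v)))
    (hS : S = fun t v => -(t * (v ⬝ᵥ w₀)) + (P (t • a) v + (E (t • a) v - E₁)))
    (hS' : S' = fun t v => -(v ⬝ᵥ w₀) + (fderiv ℝ (fun a' => P a' v) (t • a) a + fderiv ℝ (fun a' => E a' v) (t • a) a)) :
    Real.log (partFn volume w S 1)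
      = Real.log (partFn volume w S 0) + ∫ t in (0:ℝ)..1, gibbsExpect volume w S (S' t) t :=
  (domFamily_sharp C w₀ a K E₁ hKb hKm hKpos hP hE hw hS hS').eq330_family

/-- `t ↦ ⟨∂_tS_t⟩_t` is integrable on `[0,1]` (sharp cut-off). [cite: Balaban1988Convergent, (3.28) p.271] -/
theorem intervalIntegrable_gibbsExpect_S'_sharp (hKb : Bornology.IsBounded K) (hKm : MeasurableSet K) (hKpos : 0 < volume K)
    (hP : ContDiff ℝ 1 (Function.uncurry P)) (hE : ContDiff ℝ 1 (Function.uncurry E))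
    {w : (ι → ℝ) → ℝ} {S S' : ℝ → (ι → ℝ) → ℝ}
    (hw : w = fun v => K.indicator (fun _ => (1:ℝ)) v * Real.exp (-(1/2 : ℝ) * (v ⬝ᵥ C⁻¹ *ᵥ v)))
    (hS : S = fun t v => -(t * (v ⬝ᵥ w₀)) + (P (t • a) v + (E (t • a) v - E₁)))
    (hS' : S' = fun t v => -(v ⬝ᵥ w₀) + (fderiv ℝ (fun a' => P a' v) (t • a) a + fderiv ℝ (fun a' => E a' v) (t • a) a)) :
    IntervalIntegrable (fun t => gibbsExpect volume w S (S' t) t) volume 0 1 :=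
  (domFamily_sharp C w₀ a K E₁ hKb hKm hKpos hP hE hw hS hS').intervalIntegrable_logDeriv

/-! ## §2  The first printed equality of (3.28) with the sharp cut-off -/

/-- **The left-hand side of (3.28), sharp cut-off**: with the `A_k`-quadratic constant `−½⟨w₀,Cw₀⟩` of (3.25) in the exponent,
`log ∫ 𝟙_K exp[−⟨v,w₀⟩ − ½⟨w₀,Cw₀⟩ + 𝐏(a,v) + {𝐄(a,v) − 𝐄₁}] dμ_C = log Z_1 − ½⟨w₀,Cw₀⟩`.
[cite: Balaban1988Convergent, (3.28) p.271] -/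
theorem eq328_lhs_sharp (hKb : Bornology.IsBounded K) (hKm : MeasurableSet K) (hKpos : 0 < volume K) (hP : ContDiff ℝ 1 (Function.uncurry P))
    (hE : ContDiff ℝ 1 (Function.uncurry E)) {w : (ι → ℝ) → ℝ} {S : ℝ → (ι → ℝ) → ℝ}
    (hw : w = fun v => K.indicator (fun _ => (1:ℝ)) v * Real.exp (-(1/2 : ℝ) * (v ⬝ᵥ C⁻¹ *ᵥ v)))
    (hS : S = fun t v => -(t * (v ⬝ᵥ w₀)) + (P (t • a) v + (E (t • a) v - E₁))) :
    Real.log (∫ v : ι → ℝ, K.indicator (fun _ => (1:ℝ)) v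
        * Real.exp (-(v ⬝ᵥ w₀) - (1/2 : ℝ) * (w₀ ⬝ᵥ C *ᵥ w₀) + (P a v + (E a v - E₁))) * Real.exp (-(1/2 : ℝ) * (v ⬝ᵥ C⁻¹ *ᵥ v)))
      = Real.log (partFn volume w S 1) - (1/2 : ℝ) * (w₀ ⬝ᵥ C *ᵥ w₀) := by
  have hZ := partFn_pos_sharp C w₀ a K E₁ hKb hKm hKpos hP hE hw hS 1
  have h1 : (∫ v : ι → ℝ, K.indicator (fun _ => (1:ℝ)) v
        * Real.exp (-(v ⬝ᵥ w₀) - (1/2 : ℝ) * (w₀ ⬝ᵥ C *ᵥ w₀) + (P a v + (E a v - E₁))) * Real.exp (-(1/2 : ℝ) * (v ⬝ᵥ C⁻¹ *ᵥ v)))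
      = Real.exp (-((1/2 : ℝ) * (w₀ ⬝ᵥ C *ᵥ w₀))) * partFn volume w S 1 := by
    unfold partFn
    rw [← MeasureTheory.integral_const_mul]
    refine integral_congr_ae (ae_of_all _ fun v => ?_)
    simp only [gibbsWeight, hw, hS, one_smul, one_mul]
    rw [show -(v ⬝ᵥ w₀) - (1/2 : ℝ) * (w₀ ⬝ᵥ C *ᵥ w₀) + (P a v + (E a v - E₁))
        = -((1/2 : ℝ) * (w₀ ⬝ᵥ C *ᵥ w₀)) + (-(v ⬝ᵥ w₀) + (P a v + (E a v - E₁))) by ring, Real.exp_add]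
    ring
  rw [h1, Real.log_mul (Real.exp_pos _).ne' hZ.ne', Real.log_exp]
  ring

/-- **(3.28), THE FIRST PRINTED EQUALITY, WITH PRINT'S SHARP CUT-OFF `χ^{(k)} = 𝟙_K`**, for genuine Gaussian integrals:
`log ∫ 𝟙_K(v) exp[−⟨v,w₀⟩ − ½⟨w₀,Cw₀⟩ + 𝐏(a,v) + {𝐄(a,v) − 𝐄₁}] dμ_C`
`= ∫₀¹ dt ⟨−⟨v,w₀⟩ + D₁𝐏(t•a,v)·a + D₁𝐄(t•a,v)·a⟩_t − ½⟨w₀,Cw₀⟩ + log ∫ 𝟙_K(v) exp[𝐏(0,v) + {𝐄(0,v) − 𝐄₁}] dμ_C`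
(`w₀ = C*Δ^{(k)}CA_k`, `dμ_C ∝ e^{−½vᵀC⁻¹v}dv`; `⟨·⟩_t` the expectation in the sharp (3.29) measure).  No smoothness of the
cut-off is used. [cite: Balaban1988Convergent, (3.28) pp.271–272] -/
theorem eq328_first_sharp (hKb : Bornology.IsBounded K) (hKm : MeasurableSet K) (hKpos : 0 < volume K) (hP : ContDiff ℝ 1 (Function.uncurry P))
    (hE : ContDiff ℝ 1 (Function.uncurry E)) {w : (ι → ℝ) → ℝ} {S S' : ℝ → (ι → ℝ) → ℝ}
    (hw : w = fun v => K.indicator (fun _ => (1:ℝ)) v * Real.exp (-(1/2 : ℝ) * (v ⬝ᵥ C⁻¹ *ᵥ v)))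
    (hS : S = fun t v => -(t * (v ⬝ᵥ w₀)) + (P (t • a) v + (E (t • a) v - E₁)))
    (hS' : S' = fun t v => -(v ⬝ᵥ w₀) + (fderiv ℝ (fun a' => P a' v) (t • a) a + fderiv ℝ (fun a' => E a' v) (t • a) a)) :
    Real.log (∫ v : ι → ℝ, K.indicator (fun _ => (1:ℝ)) v
        * Real.exp (-(v ⬝ᵥ w₀) - (1/2 : ℝ) * (w₀ ⬝ᵥ C *ᵥ w₀) + (P a v + (E a v - E₁))) * Real.exp (-(1/2 : ℝ) * (v ⬝ᵥ C⁻¹ *ᵥ v)))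
      = (∫ t in (0:ℝ)..1, gibbsExpect volume w S (S' t) t) - (1/2 : ℝ) * (w₀ ⬝ᵥ C *ᵥ w₀)
        + Real.log (∫ v : ι → ℝ, K.indicator (fun _ => (1:ℝ)) v * Real.exp (P 0 v + (E 0 v - E₁))
            * Real.exp (-(1/2 : ℝ) * (v ⬝ᵥ C⁻¹ *ᵥ v))) := by
  rw [eq328_lhs_sharp C w₀ a K E₁ hKb hKm hKpos hP hE hw hS, eq328_ftc_sharp C w₀ a K E₁ hKb hKm hKpos hP hE hw hS hS',
    partFn_zero_eq C w₀ a E₁ hw hS]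
  ring

omit [Fintype κ] [DecidableEq ι] in
/-- Bookkeeping: an integral with the factor `𝟙_K` is the integral over `K` (*"∫ dA χ^{(k)} …"* = `∫_K dA …`).
[cite: Balaban1988Convergent, (3.29) p.272] -/
theorem integral_indicator_one_mul (hKm : MeasurableSet K) (f : (ι → ℝ) → ℝ) :
    (∫ v : ι → ℝ, K.indicator (fun _ => (1:ℝ)) v * f v) = ∫ v in K, f v := by
  rw [← integral_indicator hKm]
  refine integral_congr_ae (ae_of_all _ fun v => ?_)
  by_cases hv : v ∈ K <;> simp [hv]

/-- **(3.28), first printed equality, sharp cut-off, SET-INTEGRAL FORM**: the same identity with `∫_K` in place of the factor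
`𝟙_K`. [cite: Balaban1988Convergent, (3.28) pp.271–272] -/
theorem eq328_first_sharp_set (hKb : Bornology.IsBounded K) (hKm : MeasurableSet K) (hKpos : 0 < volume K) (hP : ContDiff ℝ 1 (Function.uncurry P))
    (hE : ContDiff ℝ 1 (Function.uncurry E)) {w : (ι → ℝ) → ℝ} {S S' : ℝ → (ι → ℝ) → ℝ}
    (hw : w = fun v => K.indicator (fun _ => (1:ℝ)) v * Real.exp (-(1/2 : ℝ) * (v ⬝ᵥ C⁻¹ *ᵥ v)))
    (hS : S = fun t v => -(t * (v ⬝ᵥ w₀)) + (P (t • a) v + (E (t • a) v - E₁)))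
    (hS' : S' = fun t v => -(v ⬝ᵥ w₀) + (fderiv ℝ (fun a' => P a' v) (t • a) a + fderiv ℝ (fun a' => E a' v) (t • a) a)) :
    Real.log (∫ v in K,
        Real.exp (-(v ⬝ᵥ w₀) - (1/2 : ℝ) * (w₀ ⬝ᵥ C *ᵥ w₀) + (P a v + (E a v - E₁))) * Real.exp (-(1/2 : ℝ) * (v ⬝ᵥ C⁻¹ *ᵥ v)))
      = (∫ t in (0:ℝ)..1, gibbsExpect volume w S (S' t) t) - (1/2 : ℝ) * (w₀ ⬝ᵥ C *ᵥ w₀)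
        + Real.log (∫ v in K, Real.exp (P 0 v + (E 0 v - E₁)) * Real.exp (-(1/2 : ℝ) * (v ⬝ᵥ C⁻¹ *ᵥ v))) := by
  have h := eq328_first_sharp C w₀ a K E₁ hKb hKm hKpos hP hE hw hS hS'
  have e1 := integral_indicator_one_mul K hKm (fun v =>
    Real.exp (-(v ⬝ᵥ w₀) - (1/2 : ℝ) * (w₀ ⬝ᵥ C *ᵥ w₀) + (P a v + (E a v - E₁))) * Real.exp (-(1/2 : ℝ) * (v ⬝ᵥ C⁻¹ *ᵥ v)))
  have e2 := integral_indicator_one_mul K hKm (fun v =>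
    Real.exp (P 0 v + (E 0 v - E₁)) * Real.exp (-(1/2 : ℝ) * (v ⬝ᵥ C⁻¹ *ᵥ v)))
  simp only [mul_assoc] at h e1 e2
  rw [e1, e2] at h
  simpa only [mul_assoc] using h

/-! ## §3  (3.29) verbatim: the sharp tilted law is a probability measure and `⟨·⟩_t` is its expectation -/

/-- **(3.29) p. 272 WITH THE SHARP CUT-OFF: `Z_t⁻¹ dμ_C(A) χ^{(k)} exp[…]`, `χ^{(k)} = 𝟙_K`, IS A PROBABILITY MEASURE for every
`t`**. [cite: Balaban1988Convergent, (3.29) p.272] -/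
theorem isProbabilityMeasure_gibbsLaw_sharp (hKb : Bornology.IsBounded K) (hKm : MeasurableSet K) (hKpos : 0 < volume K)
    (hP : ContDiff ℝ 1 (Function.uncurry P)) (hE : ContDiff ℝ 1 (Function.uncurry E))
    {w : (ι → ℝ) → ℝ} {S : ℝ → (ι → ℝ) → ℝ}
    (hw : w = fun v => K.indicator (fun _ => (1:ℝ)) v * Real.exp (-(1/2 : ℝ) * (v ⬝ᵥ C⁻¹ *ᵥ v)))
    (hS : S = fun t v => -(t * (v ⬝ᵥ w₀)) + (P (t • a) v + (E (t • a) v - E₁))) (t : ℝ) :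
    IsProbabilityMeasure (gibbsLaw volume w S t) := by
  have hZ := partFn_pos_sharp C w₀ a K E₁ hKb hKm hKpos hP hE hw hS t
  refine ⟨?_⟩
  rw [gibbsLaw, Measure.smul_apply, smul_eq_mul, withDensity_apply _ MeasurableSet.univ, Measure.restrict_univ,
    ← ofReal_integral_eq_lintegral_ofReal (integrable_gibbsWeight_sharp C w₀ a K E₁ hKb hKm hP hE hw hS t)
      (ae_of_all _ fun v => gibbsWeight_sharp_nonneg C K S hw t v)]
  exact ENNReal.inv_mul_cancel (ENNReal.ofReal_pos.2 hZ).ne' ENNReal.ofReal_ne_top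

/-- **(3.29) p. 272 WITH THE SHARP CUT-OFF: `⟨G⟩_t` IS the expectation in that measure** — `∫ G d(gibbsLaw_t) =
gibbsExpect volume w S G t = Z_t⁻¹ ∫_K G e^{S_t} dμ_C` (*"⟨·⟩_t denotes the expectation value with respect to the probabilistic
measure …"*). [cite: Balaban1988Convergent, (3.29) p.272] -/
theorem integral_gibbsLaw_sharp (hKb : Bornology.IsBounded K) (hKm : MeasurableSet K) (hKpos : 0 < volume K)
    (hP : ContDiff ℝ 1 (Function.uncurry P)) (hE : ContDiff ℝ 1 (Function.uncurry E))
    {w : (ι → ℝ) → ℝ} {S : ℝ → (ι → ℝ) → ℝ}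
    (hw : w = fun v => K.indicator (fun _ => (1:ℝ)) v * Real.exp (-(1/2 : ℝ) * (v ⬝ᵥ C⁻¹ *ᵥ v)))
    (hS : S = fun t v => -(t * (v ⬝ᵥ w₀)) + (P (t • a) v + (E (t • a) v - E₁))) (t : ℝ) (G : (ι → ℝ) → ℝ) :
    ∫ v, G v ∂(gibbsLaw volume w S t) = gibbsExpect volume w S G t := by
  have hZ := partFn_pos_sharp C w₀ a K E₁ hKb hKm hKpos hP hE hw hS t
  rw [gibbsLaw, MeasureTheory.integral_smul_measure, integral_withDensity_eq_integral_toReal_smul₀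
    (show AEMeasurable (fun v => ENNReal.ofReal (gibbsWeight w S t v)) volume from
      ENNReal.measurable_ofReal.comp_aemeasurable
        (integrable_gibbsWeight_sharp C w₀ a K E₁ hKb hKm hP hE hw hS t).aestronglyMeasurable.aemeasurable)
    (ae_of_all _ fun _ => ENNReal.ofReal_lt_top),
    ENNReal.toReal_inv, ENNReal.toReal_ofReal hZ.le, gibbsExpect, gibbsNum, div_eq_inv_mul, smul_eq_mul]
  congr 1
  refine integral_congr_ae (ae_of_all _ fun v => ?_)
  dsimp only
  rw [ENNReal.toReal_ofReal (gibbsWeight_sharp_nonneg C K S hw t v), smul_eq_mul, mul_comm]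

end Family

end Literature.MathematicalPhysics.QuantumFieldTheory.Balaban1983to89.B14.Eq328SharpCutoff

end
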